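import Literature.MathematicalPhysics.QuantumLattice.DWaveSourceNNNHoppingTwistedFlipWindowCertificate
import Literature.MathematicalPhysics.QuantumLattice.DWaveSourceNNNHoppingWindowCertificateKKTEnergy
import HarnessLib

/-!
# Window certificates for the pair-SOURCED `t–t'` torus with FLIP-TWISTED symmetry defects (sixteen point
# operations): energy-window corollaries and the energy floor

Topic `MathematicalPhysics/QuantumLattice`, family `hubbard`. Everything here is PROVED; no definition and no
named fact. Sequel of `DWaveSourceNNNHoppingTwistedFlipWindowCertificate`
(`re_orbitState_ge_of_twistedFlip_sourced_window_certificate_TT'_kkt_ineq`: ONE identity in `𝔄_{Λ'}` — SOS, commutators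
with `H^{src,tt'}_{Λ'}`, FLIP-TWISTED affine defects `bₗ • (φₗ • Γ(incl)(Γ(d4Emb γₗ wₗ)(F^{fₗ} Wₗ)) − Γ(incl) Wₗ)` over ANY
`S ⊆ D₄` closed under products, `S^z`-charged words, anti-Hermitian parts, residual words, a KKT block with ARBITRARY
generators, ONE energy term — read in the flip-twisted orbit state of every `S^z`-eigenvector ground vector of
`A_L = dWaveSourceTorusTT' L tp U μ h`), the twin of `DWaveSourceNNNHoppingTwistedWindowCertificateKKT`:

* `…_kkt_of_energy_le`, `…_kkt` (no energy term), `…_kkt_two_sided_ineq` / `…_kkt_of_energy_window`;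
* `dWaveSourceTorusTT'_groundEnergy_ge_of_twistedFlip_window_certificate_kkt[_eventually]` — the ENERGY identity gives
  `(c − Σ‖a‖)·L² ≤ E₀(A_L)` on every large torus: sourced energy floors symmetrised over the sixteen-element group.

Honest framing (cell hubbard-cq, wording W1): a finite-`h` response bound is a «finite-h response (certified)»
row at FIXED `μ`, NOT an order parameter and NOT a phase word. No certificate exists in this file.

## References
* J. Wang et al., Phys. Rev. X 14 (2024) 031006, §III. [cite: WangEtAl2024, §III]
* M. Araújo et al., arXiv:2311.18707, §3.2 Prop. 11. [cite: AraujoEtAl2023, §3.2 Prop. 11]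
* X. Han, arXiv:2006.06002 (2020), §3. [cite: Han2020Bootstrap, §3]
* O. Bratteli, D. W. Robinson II (1997), §5.2.2, Prop. 5.3.19. [cite: BratteliRobinsonII1997, Prop. 5.3.19]
-/

noncomputable section

namespace Literature.MathematicalPhysics.QuantumLattice

open Matrix Finset HubbardWave0 Literature.Probability.LatticeModels
open Literature.MathematicalPhysics.QuantumManyBody.StateRelaxation
open scoped ComplexOrder BigOperators

section TorusSourced

variable {L : ℕ} [NeZero L]

/-- (Local to this section, as in `DWaveSourceNNNHoppingWindowCertificate`.) [folklore] -/
local instance (priority := high) instDecidableEqFermionTorusSrcTwFWinKKT : DecidableEq (FermionTorus 2 L) :=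
  LinearOrder.toDecidableEq

/-- **For every ground state, with the energy hypothesis** (`κ ≥ 0`, a certified ceiling `E₀/L² ≤ u`): under the
hypotheses of `re_orbitState_ge_of_twistedFlip_sourced_window_certificate_TT'_kkt_ineq`, EVERY unit `S^z`-eigenvector
ground vector `ψ` of the pair-sourced torus obeys `c − Σₖ ‖aₖ‖ ≤ Re ω̄^{tw,F}_ψ(Γ(ι_{Λ',L}) X)`.
[cite: WangEtAl2024, §III] [cite: AraujoEtAl2023, §3.2 Prop. 11] -/
theorem re_orbitState_ge_of_twistedFlip_sourced_window_certificate_TT'_kkt_of_energy_le (tp U μ h : ℝ) (hL : 3 ≤ L)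
    {M : ℝ} {Λ Λ' : Finset (Site 2)} (hΛ : Λ ⊆ Λ') (h8 : thicken Λ 1 ⊆ Λ')
    (h0 : thicken ({0} : Finset (Site 2)) 1 ⊆ Λ') (hz : (0 : Site 2) ∈ Λ')
    (hP : pairRegion (insert (0 : Site 2) unitSteps) 0 ⊆ Λ')
    (hInj : Set.InjOn (Torus.proj (d := 2) L) ↑(thicken Λ' 1))
    (hInj' : Set.InjOn (Torus.proj (d := 2) L) ↑Λ')
    {S : Finset (DihedralGroup 4)} (h1 : (1 : DihedralGroup 4) ∈ S) (hmul : ∀ a ∈ S, ∀ b ∈ S, a * b ∈ S)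
    {ψ : Fock (Orb (FermionTorus 2 L))} (hψK : ψ ∈ fockSpinZSector (Λ := FermionTorus 2 L) M)
    (hψ1 : star ψ ⬝ᵥ ψ = 1)
    (hHψ : dWaveSourceTorusTT' L tp U μ h *ᵥ ψ =
      (((dWaveSourceTorusTT' L tp U μ h).groundEnergy : ℝ) : ℂ) • ψ)
    (Xw : FermionOp Λ') {κ u : ℝ} (hκ : 0 ≤ κ)
    (hu : (dWaveSourceTorusTT' L tp U μ h).groundEnergy / (L : ℝ) ^ 2 ≤ u)
    {m : Type*} [Fintype m] [DecidableEq m] {Λm : Matrix m m ℂ} (hΛm : Λm.PosSemidef)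
    (O : m → FermionOp Λ')
    {κ' : Type*} (s : Finset κ') (B : κ' → FermionOp Λ)
    {ι : Type*} (tt : Finset ι) (γ : ι → DihedralGroup 4) (hγS : ∀ l ∈ tt, γ l ∈ S) (wv : ι → Site 2)
    (fl mt : ι → Fin 2) (hsh : ∀ l, d4ShiftSet (γ l) (wv l) Λ ⊆ Λ') (bb : ι → ℂ)
    (yw : ι → List (Orb (PolySite Λ) × Bool))
    {ρ : Type*} (uu : Finset ρ) (b : ρ → ℂ) (cw : ρ → List (Orb (PolySite Λ') × Bool))
    (hcw : ∀ j ∈ uu, ladderSpinCharge (cw j) ≠ 0)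
    {δ : Type*} (ah : Finset δ) (dc : δ → ℝ) (V : δ → FermionOp Λ')
    {κ'' : Type*} (w : Finset κ'') (a : κ'' → ℂ) (word : κ'' → List (Orb (PolySite Λ') × Bool))
    {β : Type*} [Fintype β] [DecidableEq β] {G : Matrix β β ℂ} (hG : G.PosSemidef)
    (Bk : β → FermionOp Λ) {c : ℝ}
    (hcert : Xw - (c : ℂ) • (1 : FermionOp Λ') -
        ((κ : ℝ) : ℂ) • (((u : ℝ) : ℂ) • (1 : FermionOp Λ') -
          (fermionEmbed (PolySite.incl h0) ((hubbardTTPrimeFermionInteraction 1 tp U).meanEnergyObs 1) -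
            (μ : ℂ) • ∑ σ : Fin 2, nAt 0 hz σ -
            (h : ℂ) • (fermionEmbed (PolySite.incl hP) (localPairAt (insert (0 : Site 2) unitSteps) dWaveFormFactor 0) +
              (fermionEmbed (PolySite.incl hP) (localPairAt (insert (0 : Site 2) unitSteps) dWaveFormFactor 0))ᴴ))) =
      gramForm Λm O +
        (∑ k ∈ s, (pairSourceWindowHamiltonianTT' dWaveFormFactor Λ' tp U μ h * fermionEmbed (PolySite.incl hΛ) (B k) -
            fermionEmbed (PolySite.incl hΛ) (B k) * pairSourceWindowHamiltonianTT' dWaveFormFactor Λ' tp U μ h) +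
          ∑ l ∈ tt, bb l • (gaugePhase (twistFlipExp (γ l) (fl l) (mt l)) (yw l) •
              fermionEmbed (PolySite.incl (hsh l))
                (fermionEmbed (PolySite.d4Emb (γ l) (wv l) Λ) (spinSwapIter (fl l).val (ladderWord (yw l)))) -
            fermionEmbed (PolySite.incl hΛ) (ladderWord (yw l))) +
          ∑ j ∈ uu, b j • ladderWord (cw j)) +
        (∑ m' ∈ ah, ((dc m' : ℝ) : ℂ) • ((V m')ᴴ - V m') + ∑ k ∈ w, a k • ladderWord (word k)) +
        kktForm (pairSourceWindowHamiltonianTT' dWaveFormFactor Λ' tp U μ h) G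
          (fun b' => fermionEmbed (PolySite.incl hΛ) (Bk b'))) :
    c - ∑ k ∈ w, ‖a k‖ ≤
      (orbitState (twistedFlipSpaceGroupUnitary S) ψ (fermionEmbed (PolySite.toTorusEmb L hInj') Xw)).re := by
  have hmain := re_orbitState_ge_of_twistedFlip_sourced_window_certificate_TT'_kkt_ineq tp U μ h hL hΛ h8 h0 hz hP hInj
    hInj' h1 hmul hψK hψ1 hHψ Xw κ u hΛm O s B tt γ hγS wv fl mt hsh bb yw uu b cw hcw ah dc V w a word hG Bk hcert
  have hslack : 0 ≤ κ * (u - (dWaveSourceTorusTT' L tp U μ h).groundEnergy / (L : ℝ) ^ 2) :=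
    mul_nonneg hκ (sub_nonneg.2 hu)
  linarith

/-- **Ground-state rows only (no energy constraint in the identity), twisted defects.** The identity
`X − c·1 = SOS + Σ[H^{src,tt'}_{Λ'}, Γ(incl)Bₖ] + Σ bₗ • (φₗ • Γ(incl)(Γ(d4Emb γₗ wₗ) Wₗ) − Γ(incl) Wₗ) + Σ b'ⱼ wⱼ
 + Σ dₘ(Vₘᴴ − Vₘ) + Σ aₖ vₖ + kktForm H^{src,tt'}_{Λ'} G (Γ(incl) ∘ B)` — a one-point MIN/MAX program whose only
ground-state-specific rows are KKT rows, symmetrised over the full group — gives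
`c − Σₖ ‖aₖ‖ ≤ Re ω̄^{tw,F}_ψ(Γ(ι_{Λ',L}) X)` for every unit `S^z`-eigenvector ground vector of every large pair-sourced
torus. [cite: WangEtAl2024, §III] [cite: AraujoEtAl2023, §3.2 Prop. 11] -/
theorem re_orbitState_ge_of_twistedFlip_sourced_window_certificate_TT'_kkt (tp U μ h : ℝ) (hL : 3 ≤ L)
    {M : ℝ} {Λ Λ' : Finset (Site 2)} (hΛ : Λ ⊆ Λ') (h8 : thicken Λ 1 ⊆ Λ')
    (h0 : thicken ({0} : Finset (Site 2)) 1 ⊆ Λ') (hz : (0 : Site 2) ∈ Λ')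
    (hP : pairRegion (insert (0 : Site 2) unitSteps) 0 ⊆ Λ')
    (hInj : Set.InjOn (Torus.proj (d := 2) L) ↑(thicken Λ' 1))
    (hInj' : Set.InjOn (Torus.proj (d := 2) L) ↑Λ')
    {S : Finset (DihedralGroup 4)} (h1 : (1 : DihedralGroup 4) ∈ S) (hmul : ∀ a ∈ S, ∀ b ∈ S, a * b ∈ S)
    {ψ : Fock (Orb (FermionTorus 2 L))} (hψK : ψ ∈ fockSpinZSector (Λ := FermionTorus 2 L) M)
    (hψ1 : star ψ ⬝ᵥ ψ = 1)
    (hHψ : dWaveSourceTorusTT' L tp U μ h *ᵥ ψ =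
      (((dWaveSourceTorusTT' L tp U μ h).groundEnergy : ℝ) : ℂ) • ψ)
    (Xw : FermionOp Λ')
    {m : Type*} [Fintype m] [DecidableEq m] {Λm : Matrix m m ℂ} (hΛm : Λm.PosSemidef)
    (O : m → FermionOp Λ')
    {κ' : Type*} (s : Finset κ') (B : κ' → FermionOp Λ)
    {ι : Type*} (tt : Finset ι) (γ : ι → DihedralGroup 4) (hγS : ∀ l ∈ tt, γ l ∈ S) (wv : ι → Site 2)
    (fl mt : ι → Fin 2) (hsh : ∀ l, d4ShiftSet (γ l) (wv l) Λ ⊆ Λ') (bb : ι → ℂ)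
    (yw : ι → List (Orb (PolySite Λ) × Bool))
    {ρ : Type*} (uu : Finset ρ) (b : ρ → ℂ) (cw : ρ → List (Orb (PolySite Λ') × Bool))
    (hcw : ∀ j ∈ uu, ladderSpinCharge (cw j) ≠ 0)
    {δ : Type*} (ah : Finset δ) (dc : δ → ℝ) (V : δ → FermionOp Λ')
    {κ'' : Type*} (w : Finset κ'') (a : κ'' → ℂ) (word : κ'' → List (Orb (PolySite Λ') × Bool))
    {β : Type*} [Fintype β] [DecidableEq β] {G : Matrix β β ℂ} (hG : G.PosSemidef)
    (Bk : β → FermionOp Λ) {c : ℝ}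
    (hcert : Xw - (c : ℂ) • (1 : FermionOp Λ') =
      gramForm Λm O +
        (∑ k ∈ s, (pairSourceWindowHamiltonianTT' dWaveFormFactor Λ' tp U μ h * fermionEmbed (PolySite.incl hΛ) (B k) -
            fermionEmbed (PolySite.incl hΛ) (B k) * pairSourceWindowHamiltonianTT' dWaveFormFactor Λ' tp U μ h) +
          ∑ l ∈ tt, bb l • (gaugePhase (twistFlipExp (γ l) (fl l) (mt l)) (yw l) •
              fermionEmbed (PolySite.incl (hsh l))
                (fermionEmbed (PolySite.d4Emb (γ l) (wv l) Λ) (spinSwapIter (fl l).val (ladderWord (yw l)))) -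
            fermionEmbed (PolySite.incl hΛ) (ladderWord (yw l))) +
          ∑ j ∈ uu, b j • ladderWord (cw j)) +
        (∑ m' ∈ ah, ((dc m' : ℝ) : ℂ) • ((V m')ᴴ - V m') + ∑ k ∈ w, a k • ladderWord (word k)) +
        kktForm (pairSourceWindowHamiltonianTT' dWaveFormFactor Λ' tp U μ h) G
          (fun b' => fermionEmbed (PolySite.incl hΛ) (Bk b'))) :
    c - ∑ k ∈ w, ‖a k‖ ≤
      (orbitState (twistedFlipSpaceGroupUnitary S) ψ (fermionEmbed (PolySite.toTorusEmb L hInj') Xw)).re := by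
  have hcert' : Xw - (c : ℂ) • (1 : FermionOp Λ') -
      (((0 : ℝ) : ℝ) : ℂ) • ((((0 : ℝ) : ℝ) : ℂ) • (1 : FermionOp Λ') -
        (fermionEmbed (PolySite.incl h0) ((hubbardTTPrimeFermionInteraction 1 tp U).meanEnergyObs 1) -
          (μ : ℂ) • ∑ σ : Fin 2, nAt 0 hz σ -
          (h : ℂ) • (fermionEmbed (PolySite.incl hP) (localPairAt (insert (0 : Site 2) unitSteps) dWaveFormFactor 0) +
            (fermionEmbed (PolySite.incl hP) (localPairAt (insert (0 : Site 2) unitSteps) dWaveFormFactor 0))ᴴ))) =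
      gramForm Λm O +
        (∑ k ∈ s, (pairSourceWindowHamiltonianTT' dWaveFormFactor Λ' tp U μ h * fermionEmbed (PolySite.incl hΛ) (B k) -
            fermionEmbed (PolySite.incl hΛ) (B k) * pairSourceWindowHamiltonianTT' dWaveFormFactor Λ' tp U μ h) +
          ∑ l ∈ tt, bb l • (gaugePhase (twistFlipExp (γ l) (fl l) (mt l)) (yw l) •
              fermionEmbed (PolySite.incl (hsh l))
                (fermionEmbed (PolySite.d4Emb (γ l) (wv l) Λ) (spinSwapIter (fl l).val (ladderWord (yw l)))) -
            fermionEmbed (PolySite.incl hΛ) (ladderWord (yw l))) +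
          ∑ j ∈ uu, b j • ladderWord (cw j)) +
        (∑ m' ∈ ah, ((dc m' : ℝ) : ℂ) • ((V m')ᴴ - V m') + ∑ k ∈ w, a k • ladderWord (word k)) +
        kktForm (pairSourceWindowHamiltonianTT' dWaveFormFactor Λ' tp U μ h) G
          (fun b' => fermionEmbed (PolySite.incl hΛ) (Bk b')) := by
    rw [Complex.ofReal_zero, zero_smul, sub_zero]
    exact hcert
  have hmain := re_orbitState_ge_of_twistedFlip_sourced_window_certificate_TT'_kkt_ineq tp U μ h hL hΛ h8 h0 hz hP hInj
    hInj' h1 hmul hψK hψ1 hHψ Xw 0 0 hΛm O s B tt γ hγS wv fl mt hsh bb yw uu b cw hcw ah dc V w a word hG Bk hcert'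
  rw [zero_mul, add_zero] at hmain
  exact hmain

/-- **Two energy terms are one**: `X − c·1 − κ⁺(u·1 − E) − κ⁻(E − ℓ·1) = R` rewrites as
`X − (c + κ⁺u − κ⁻ℓ)·1 − (κ⁺ − κ⁻)(0·1 − E) = R`. [folklore] -/
private theorem cert_two_sided_energy_window_twf {A : Type*} [AddCommGroup A] [Module ℂ A] (X one E R : A)
    (c κp κm u ℓ : ℝ)
    (hcert : X - (c : ℂ) • one - ((κp : ℝ) : ℂ) • (((u : ℝ) : ℂ) • one - E) -
        ((κm : ℝ) : ℂ) • (E - ((ℓ : ℝ) : ℂ) • one) = R) :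
    X - (((c + κp * u - κm * ℓ : ℝ)) : ℂ) • one -
        (((κp - κm : ℝ)) : ℂ) • ((((0 : ℝ) : ℝ) : ℂ) • one - E) = R := by
  rw [← hcert]
  push_cast
  module

/-- **Twisted defects, KKT block and a TWO-SIDED energy window, inequality form**: the identity carries
`κ⁺ (u·1 − E^{src,tt'}) + κ⁻ (E^{src,tt'} − ℓ·1)` (`κ⁺, κ⁻, u, ℓ` arbitrary reals); then
`c − Σₖ ‖aₖ‖ + κ⁺ (u − E₀/L²) + κ⁻ (E₀/L² − ℓ) ≤ Re ω̄^{tw,F}_ψ(Γ(ι_{Λ',L}) X)` for every unit `S^z`-eigenvector ground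
vector. [cite: WangEtAl2024, §III] [cite: AraujoEtAl2023, §3.2 Prop. 11] -/
theorem re_orbitState_ge_of_twistedFlip_sourced_window_certificate_TT'_kkt_two_sided_ineq (tp U μ h : ℝ)
    (hL : 3 ≤ L) {M : ℝ} {Λ Λ' : Finset (Site 2)} (hΛ : Λ ⊆ Λ') (h8 : thicken Λ 1 ⊆ Λ')
    (h0 : thicken ({0} : Finset (Site 2)) 1 ⊆ Λ') (hz : (0 : Site 2) ∈ Λ')
    (hP : pairRegion (insert (0 : Site 2) unitSteps) 0 ⊆ Λ')
    (hInj : Set.InjOn (Torus.proj (d := 2) L) ↑(thicken Λ' 1))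
    (hInj' : Set.InjOn (Torus.proj (d := 2) L) ↑Λ')
    {S : Finset (DihedralGroup 4)} (h1 : (1 : DihedralGroup 4) ∈ S) (hmul : ∀ a ∈ S, ∀ b ∈ S, a * b ∈ S)
    {ψ : Fock (Orb (FermionTorus 2 L))} (hψK : ψ ∈ fockSpinZSector (Λ := FermionTorus 2 L) M)
    (hψ1 : star ψ ⬝ᵥ ψ = 1)
    (hHψ : dWaveSourceTorusTT' L tp U μ h *ᵥ ψ =
      (((dWaveSourceTorusTT' L tp U μ h).groundEnergy : ℝ) : ℂ) • ψ)
    (Xw : FermionOp Λ') (κp κm u ℓ : ℝ)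
    {m : Type*} [Fintype m] [DecidableEq m] {Λm : Matrix m m ℂ} (hΛm : Λm.PosSemidef)
    (O : m → FermionOp Λ')
    {κ' : Type*} (s : Finset κ') (B : κ' → FermionOp Λ)
    {ι : Type*} (tt : Finset ι) (γ : ι → DihedralGroup 4) (hγS : ∀ l ∈ tt, γ l ∈ S) (wv : ι → Site 2)
    (fl mt : ι → Fin 2) (hsh : ∀ l, d4ShiftSet (γ l) (wv l) Λ ⊆ Λ') (bb : ι → ℂ)
    (yw : ι → List (Orb (PolySite Λ) × Bool))
    {ρ : Type*} (uu : Finset ρ) (b : ρ → ℂ) (cw : ρ → List (Orb (PolySite Λ') × Bool))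
    (hcw : ∀ j ∈ uu, ladderSpinCharge (cw j) ≠ 0)
    {δ : Type*} (ah : Finset δ) (dc : δ → ℝ) (V : δ → FermionOp Λ')
    {κ'' : Type*} (w : Finset κ'') (a : κ'' → ℂ) (word : κ'' → List (Orb (PolySite Λ') × Bool))
    {β : Type*} [Fintype β] [DecidableEq β] {G : Matrix β β ℂ} (hG : G.PosSemidef)
    (Bk : β → FermionOp Λ) {c : ℝ}
    (hcert : Xw - (c : ℂ) • (1 : FermionOp Λ') -
        ((κp : ℝ) : ℂ) • (((u : ℝ) : ℂ) • (1 : FermionOp Λ') -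
          (fermionEmbed (PolySite.incl h0) ((hubbardTTPrimeFermionInteraction 1 tp U).meanEnergyObs 1) -
            (μ : ℂ) • ∑ σ : Fin 2, nAt 0 hz σ -
            (h : ℂ) • (fermionEmbed (PolySite.incl hP) (localPairAt (insert (0 : Site 2) unitSteps) dWaveFormFactor 0) +
              (fermionEmbed (PolySite.incl hP) (localPairAt (insert (0 : Site 2) unitSteps) dWaveFormFactor 0))ᴴ))) -
        ((κm : ℝ) : ℂ) • ((fermionEmbed (PolySite.incl h0) ((hubbardTTPrimeFermionInteraction 1 tp U).meanEnergyObs 1) -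
            (μ : ℂ) • ∑ σ : Fin 2, nAt 0 hz σ -
            (h : ℂ) • (fermionEmbed (PolySite.incl hP) (localPairAt (insert (0 : Site 2) unitSteps) dWaveFormFactor 0) +
              (fermionEmbed (PolySite.incl hP) (localPairAt (insert (0 : Site 2) unitSteps) dWaveFormFactor 0))ᴴ)) -
          ((ℓ : ℝ) : ℂ) • (1 : FermionOp Λ')) =
      gramForm Λm O +
        (∑ k ∈ s, (pairSourceWindowHamiltonianTT' dWaveFormFactor Λ' tp U μ h * fermionEmbed (PolySite.incl hΛ) (B k) -
            fermionEmbed (PolySite.incl hΛ) (B k) * pairSourceWindowHamiltonianTT' dWaveFormFactor Λ' tp U μ h) +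
          ∑ l ∈ tt, bb l • (gaugePhase (twistFlipExp (γ l) (fl l) (mt l)) (yw l) •
              fermionEmbed (PolySite.incl (hsh l))
                (fermionEmbed (PolySite.d4Emb (γ l) (wv l) Λ) (spinSwapIter (fl l).val (ladderWord (yw l)))) -
            fermionEmbed (PolySite.incl hΛ) (ladderWord (yw l))) +
          ∑ j ∈ uu, b j • ladderWord (cw j)) +
        (∑ m' ∈ ah, ((dc m' : ℝ) : ℂ) • ((V m')ᴴ - V m') + ∑ k ∈ w, a k • ladderWord (word k)) +
        kktForm (pairSourceWindowHamiltonianTT' dWaveFormFactor Λ' tp U μ h) G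
          (fun b' => fermionEmbed (PolySite.incl hΛ) (Bk b'))) :
    c - ∑ k ∈ w, ‖a k‖ + κp * (u - (dWaveSourceTorusTT' L tp U μ h).groundEnergy / (L : ℝ) ^ 2) +
        κm * ((dWaveSourceTorusTT' L tp U μ h).groundEnergy / (L : ℝ) ^ 2 - ℓ) ≤
      (orbitState (twistedFlipSpaceGroupUnitary S) ψ (fermionEmbed (PolySite.toTorusEmb L hInj') Xw)).re := by
  have hcert' := cert_two_sided_energy_window_twf Xw (1 : FermionOp Λ')
    (fermionEmbed (PolySite.incl h0) ((hubbardTTPrimeFermionInteraction 1 tp U).meanEnergyObs 1) -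
      (μ : ℂ) • ∑ σ : Fin 2, nAt 0 hz σ -
      (h : ℂ) • (fermionEmbed (PolySite.incl hP) (localPairAt (insert (0 : Site 2) unitSteps) dWaveFormFactor 0) +
        (fermionEmbed (PolySite.incl hP) (localPairAt (insert (0 : Site 2) unitSteps) dWaveFormFactor 0))ᴴ)) _
    c κp κm u ℓ hcert
  have hmain := re_orbitState_ge_of_twistedFlip_sourced_window_certificate_TT'_kkt_ineq tp U μ h hL hΛ h8 h0 hz hP hInj
    hInj' h1 hmul hψK hψ1 hHψ Xw (κp - κm) 0 hΛm O s B tt γ hγS wv fl mt hsh bb yw uu b cw hcw ah dc V w a word hG Bk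
    hcert'
  have hring : c + κp * u - κm * ℓ - ∑ k ∈ w, ‖a k‖ +
      (κp - κm) * (0 - (dWaveSourceTorusTT' L tp U μ h).groundEnergy / (L : ℝ) ^ 2) =
      c - ∑ k ∈ w, ‖a k‖ + κp * (u - (dWaveSourceTorusTT' L tp U μ h).groundEnergy / (L : ℝ) ^ 2) +
        κm * ((dWaveSourceTorusTT' L tp U μ h).groundEnergy / (L : ℝ) ^ 2 - ℓ) := by
    ring
  rw [hring] at hmain
  exact hmain

/-- **For every ground state, inside a certified two-sided energy window, twisted defects** (`κ⁺, κ⁻ ≥ 0`,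
`E₀/L² ≤ u`, `ℓ ≤ E₀/L²`): `c − Σₖ ‖aₖ‖ ≤ Re ω̄^{tw,F}_ψ(Γ(ι_{Λ',L}) X)`. [cite: WangEtAl2024, §III]
[cite: AraujoEtAl2023, §3.2 Prop. 11] -/
theorem re_orbitState_ge_of_twistedFlip_sourced_window_certificate_TT'_kkt_of_energy_window (tp U μ h : ℝ)
    (hL : 3 ≤ L) {M : ℝ} {Λ Λ' : Finset (Site 2)} (hΛ : Λ ⊆ Λ') (h8 : thicken Λ 1 ⊆ Λ')
    (h0 : thicken ({0} : Finset (Site 2)) 1 ⊆ Λ') (hz : (0 : Site 2) ∈ Λ')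
    (hP : pairRegion (insert (0 : Site 2) unitSteps) 0 ⊆ Λ')
    (hInj : Set.InjOn (Torus.proj (d := 2) L) ↑(thicken Λ' 1))
    (hInj' : Set.InjOn (Torus.proj (d := 2) L) ↑Λ')
    {S : Finset (DihedralGroup 4)} (h1 : (1 : DihedralGroup 4) ∈ S) (hmul : ∀ a ∈ S, ∀ b ∈ S, a * b ∈ S)
    {ψ : Fock (Orb (FermionTorus 2 L))} (hψK : ψ ∈ fockSpinZSector (Λ := FermionTorus 2 L) M)
    (hψ1 : star ψ ⬝ᵥ ψ = 1)
    (hHψ : dWaveSourceTorusTT' L tp U μ h *ᵥ ψ =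
      (((dWaveSourceTorusTT' L tp U μ h).groundEnergy : ℝ) : ℂ) • ψ)
    (Xw : FermionOp Λ') {κp κm u ℓ : ℝ} (hκp : 0 ≤ κp) (hκm : 0 ≤ κm)
    (hu : (dWaveSourceTorusTT' L tp U μ h).groundEnergy / (L : ℝ) ^ 2 ≤ u)
    (hℓ : ℓ ≤ (dWaveSourceTorusTT' L tp U μ h).groundEnergy / (L : ℝ) ^ 2)
    {m : Type*} [Fintype m] [DecidableEq m] {Λm : Matrix m m ℂ} (hΛm : Λm.PosSemidef)
    (O : m → FermionOp Λ')
    {κ' : Type*} (s : Finset κ') (B : κ' → FermionOp Λ)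
    {ι : Type*} (tt : Finset ι) (γ : ι → DihedralGroup 4) (hγS : ∀ l ∈ tt, γ l ∈ S) (wv : ι → Site 2)
    (fl mt : ι → Fin 2) (hsh : ∀ l, d4ShiftSet (γ l) (wv l) Λ ⊆ Λ') (bb : ι → ℂ)
    (yw : ι → List (Orb (PolySite Λ) × Bool))
    {ρ : Type*} (uu : Finset ρ) (b : ρ → ℂ) (cw : ρ → List (Orb (PolySite Λ') × Bool))
    (hcw : ∀ j ∈ uu, ladderSpinCharge (cw j) ≠ 0)
    {δ : Type*} (ah : Finset δ) (dc : δ → ℝ) (V : δ → FermionOp Λ')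
    {κ'' : Type*} (w : Finset κ'') (a : κ'' → ℂ) (word : κ'' → List (Orb (PolySite Λ') × Bool))
    {β : Type*} [Fintype β] [DecidableEq β] {G : Matrix β β ℂ} (hG : G.PosSemidef)
    (Bk : β → FermionOp Λ) {c : ℝ}
    (hcert : Xw - (c : ℂ) • (1 : FermionOp Λ') -
        ((κp : ℝ) : ℂ) • (((u : ℝ) : ℂ) • (1 : FermionOp Λ') -
          (fermionEmbed (PolySite.incl h0) ((hubbardTTPrimeFermionInteraction 1 tp U).meanEnergyObs 1) -
            (μ : ℂ) • ∑ σ : Fin 2, nAt 0 hz σ -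
            (h : ℂ) • (fermionEmbed (PolySite.incl hP) (localPairAt (insert (0 : Site 2) unitSteps) dWaveFormFactor 0) +
              (fermionEmbed (PolySite.incl hP) (localPairAt (insert (0 : Site 2) unitSteps) dWaveFormFactor 0))ᴴ))) -
        ((κm : ℝ) : ℂ) • ((fermionEmbed (PolySite.incl h0) ((hubbardTTPrimeFermionInteraction 1 tp U).meanEnergyObs 1) -
            (μ : ℂ) • ∑ σ : Fin 2, nAt 0 hz σ -
            (h : ℂ) • (fermionEmbed (PolySite.incl hP) (localPairAt (insert (0 : Site 2) unitSteps) dWaveFormFactor 0) +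
              (fermionEmbed (PolySite.incl hP) (localPairAt (insert (0 : Site 2) unitSteps) dWaveFormFactor 0))ᴴ)) -
          ((ℓ : ℝ) : ℂ) • (1 : FermionOp Λ')) =
      gramForm Λm O +
        (∑ k ∈ s, (pairSourceWindowHamiltonianTT' dWaveFormFactor Λ' tp U μ h * fermionEmbed (PolySite.incl hΛ) (B k) -
            fermionEmbed (PolySite.incl hΛ) (B k) * pairSourceWindowHamiltonianTT' dWaveFormFactor Λ' tp U μ h) +
          ∑ l ∈ tt, bb l • (gaugePhase (twistFlipExp (γ l) (fl l) (mt l)) (yw l) •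
              fermionEmbed (PolySite.incl (hsh l))
                (fermionEmbed (PolySite.d4Emb (γ l) (wv l) Λ) (spinSwapIter (fl l).val (ladderWord (yw l)))) -
            fermionEmbed (PolySite.incl hΛ) (ladderWord (yw l))) +
          ∑ j ∈ uu, b j • ladderWord (cw j)) +
        (∑ m' ∈ ah, ((dc m' : ℝ) : ℂ) • ((V m')ᴴ - V m') + ∑ k ∈ w, a k • ladderWord (word k)) +
        kktForm (pairSourceWindowHamiltonianTT' dWaveFormFactor Λ' tp U μ h) G
          (fun b' => fermionEmbed (PolySite.incl hΛ) (Bk b'))) :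
    c - ∑ k ∈ w, ‖a k‖ ≤
      (orbitState (twistedFlipSpaceGroupUnitary S) ψ (fermionEmbed (PolySite.toTorusEmb L hInj') Xw)).re := by
  have hmain := re_orbitState_ge_of_twistedFlip_sourced_window_certificate_TT'_kkt_two_sided_ineq tp U μ h hL hΛ h8 h0
    hz hP hInj hInj' h1 hmul hψK hψ1 hHψ Xw κp κm u ℓ hΛm O s B tt γ hγS wv fl mt hsh bb yw uu b cw hcw ah dc V w a word
    hG Bk hcert
  have hslack₁ : 0 ≤ κp * (u - (dWaveSourceTorusTT' L tp U μ h).groundEnergy / (L : ℝ) ^ 2) :=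
    mul_nonneg hκp (sub_nonneg.2 hu)
  have hslack₂ : 0 ≤ κm * ((dWaveSourceTorusTT' L tp U μ h).groundEnergy / (L : ℝ) ^ 2 - ℓ) :=
    mul_nonneg hκm (sub_nonneg.2 hℓ)
  linarith

/-- **Twisted window certificate with a KKT block ⇒ ground-state ENERGY of every large pair-sourced `t–t'` torus.**
The identity in `𝔄_{Λ'}` (flip-twisted defects over ALL of `D₄ × ℤ₂^{flip}`, `S^z`-charged `wⱼ`, `G ⪰ 0`, ARBITRARY generators)
`E^{src,tt'} − c·1 = Σ Λₐᵦ Oₐᴴ O_b + (Σₖ [H^{src,tt'}_{Λ'}, Γ(incl)Bₖ] + Σₗ bₗ • (φₗ • Γ(incl)(Γ(d4Emb γₗ wₗ) Wₗ) − Γ(incl) Wₗ)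
 + Σⱼ b'ⱼ • wⱼ) + (Σₘ dₘ • (Vₘᴴ − Vₘ) + Σₖ aₖ • vₖ) + kktForm H^{src,tt'}_{Λ'} G (Γ(incl) ∘ B)`
gives, for every `L ≥ 3` with `x ↦ x mod L` injective on `thicken Λ' 1`,
`(c − Σₖ ‖aₖ‖) · L² ≤ E₀(dWaveSourceTorusTT' L tp U μ h)` — the observable row with zero objective and unit
energy weight, read in the flip-twisted orbit state of one `S^z`-eigenvector ground vector.
[cite: AraujoEtAl2023, §3.2 Prop. 11] [cite: Han2020Bootstrap, §3] -/
theorem dWaveSourceTorusTT'_groundEnergy_ge_of_twistedFlip_window_certificate_kkt (tp U μ h : ℝ) (hL : 3 ≤ L)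
    {Λ Λ' : Finset (Site 2)} (hΛ : Λ ⊆ Λ') (h8 : thicken Λ 1 ⊆ Λ')
    (h0 : thicken ({0} : Finset (Site 2)) 1 ⊆ Λ') (hz : (0 : Site 2) ∈ Λ')
    (hP : pairRegion (insert (0 : Site 2) unitSteps) 0 ⊆ Λ')
    (hInj : Set.InjOn (Torus.proj (d := 2) L) ↑(thicken Λ' 1))
    {m : Type*} [Fintype m] [DecidableEq m] {Λm : Matrix m m ℂ} (hΛm : Λm.PosSemidef)
    (O : m → FermionOp Λ')
    {κ : Type*} (s : Finset κ) (B : κ → FermionOp Λ)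
    {ι : Type*} (tt : Finset ι) (γ : ι → DihedralGroup 4) (wv : ι → Site 2) (fl mt : ι → Fin 2)
    (hsh : ∀ l, d4ShiftSet (γ l) (wv l) Λ ⊆ Λ') (bb : ι → ℂ) (yw : ι → List (Orb (PolySite Λ) × Bool))
    {χ : Type*} (u : Finset χ) (b : χ → ℂ) (cw : χ → List (Orb (PolySite Λ') × Bool))
    (hcw : ∀ j ∈ u, ladderSpinCharge (cw j) ≠ 0)
    {δ : Type*} (ah : Finset δ) (dc : δ → ℝ) (V : δ → FermionOp Λ')
    {κ'' : Type*} (w : Finset κ'') (a : κ'' → ℂ) (word : κ'' → List (Orb (PolySite Λ') × Bool))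
    {β : Type*} [Fintype β] [DecidableEq β] {G : Matrix β β ℂ} (hG : G.PosSemidef)
    (Bk : β → FermionOp Λ) {c : ℝ}
    (hcert : fermionEmbed (PolySite.incl h0) ((hubbardTTPrimeFermionInteraction 1 tp U).meanEnergyObs 1) -
          (μ : ℂ) • ∑ σ : Fin 2, nAt 0 hz σ -
          (h : ℂ) • (fermionEmbed (PolySite.incl hP) (localPairAt (insert (0 : Site 2) unitSteps) dWaveFormFactor 0) +
            (fermionEmbed (PolySite.incl hP) (localPairAt (insert (0 : Site 2) unitSteps) dWaveFormFactor 0))ᴴ) -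
        (c : ℂ) • (1 : FermionOp Λ') =
      gramForm Λm O +
        (∑ k ∈ s, (pairSourceWindowHamiltonianTT' dWaveFormFactor Λ' tp U μ h * fermionEmbed (PolySite.incl hΛ) (B k) -
            fermionEmbed (PolySite.incl hΛ) (B k) * pairSourceWindowHamiltonianTT' dWaveFormFactor Λ' tp U μ h) +
          ∑ l ∈ tt, bb l • (gaugePhase (twistFlipExp (γ l) (fl l) (mt l)) (yw l) •
              fermionEmbed (PolySite.incl (hsh l))
                (fermionEmbed (PolySite.d4Emb (γ l) (wv l) Λ) (spinSwapIter (fl l).val (ladderWord (yw l)))) -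
            fermionEmbed (PolySite.incl hΛ) (ladderWord (yw l))) +
          ∑ j ∈ u, b j • ladderWord (cw j)) +
        (∑ m' ∈ ah, ((dc m' : ℝ) : ℂ) • ((V m')ᴴ - V m') + ∑ k ∈ w, a k • ladderWord (word k)) +
        kktForm (pairSourceWindowHamiltonianTT' dWaveFormFactor Λ' tp U μ h) G
          (fun b' => fermionEmbed (PolySite.incl hΛ) (Bk b'))) :
    (c - ∑ k ∈ w, ‖a k‖) * (L : ℝ) ^ 2 ≤ (dWaveSourceTorusTT' L tp U μ h).groundEnergy := by
  classical
  have hInj' : Set.InjOn (Torus.proj (d := 2) L) ↑Λ' := hInj.mono (by exact_mod_cast subset_thicken Λ' 1)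
  -- the label set: all of `D₄`
  have h1S : (1 : DihedralGroup 4) ∈ (Finset.univ : Finset (DihedralGroup 4)) := Finset.mem_univ _
  have hmulS : ∀ a' ∈ (Finset.univ : Finset (DihedralGroup 4)), ∀ b' ∈ (Finset.univ : Finset (DihedralGroup 4)),
      a' * b' ∈ (Finset.univ : Finset (DihedralGroup 4)) := fun _ _ _ _ => Finset.mem_univ _
  have hγS : ∀ l ∈ tt, γ l ∈ (Finset.univ : Finset (DihedralGroup 4)) := fun _ _ => Finset.mem_univ _
  -- one `S^z`-eigenvector ground vector
  obtain ⟨M, ψ, hψK, hψ1, hHψ⟩ := exists_unit_groundState_mem_fockSpinZSector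
    (dWaveSourceTorusTT' L tp U μ h) (dWaveSourceTorusTT'_isHermitian L tp U μ h)
    (spinZ_mul_dWaveSourceTorusTT' (L := L) tp U μ h)
  -- the energy identity as an observable identity with zero objective and unit energy weight
  have hcert' : (0 : FermionOp Λ') - (((0 : ℝ) : ℝ) : ℂ) • (1 : FermionOp Λ') -
      (((1 : ℝ) : ℝ) : ℂ) • ((((c : ℝ) : ℝ) : ℂ) • (1 : FermionOp Λ') -
        (fermionEmbed (PolySite.incl h0) ((hubbardTTPrimeFermionInteraction 1 tp U).meanEnergyObs 1) -
          (μ : ℂ) • ∑ σ : Fin 2, nAt 0 hz σ -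
          (h : ℂ) • (fermionEmbed (PolySite.incl hP) (localPairAt (insert (0 : Site 2) unitSteps) dWaveFormFactor 0) +
            (fermionEmbed (PolySite.incl hP) (localPairAt (insert (0 : Site 2) unitSteps) dWaveFormFactor 0))ᴴ))) =
      gramForm Λm O +
        (∑ k ∈ s, (pairSourceWindowHamiltonianTT' dWaveFormFactor Λ' tp U μ h * fermionEmbed (PolySite.incl hΛ) (B k) -
            fermionEmbed (PolySite.incl hΛ) (B k) * pairSourceWindowHamiltonianTT' dWaveFormFactor Λ' tp U μ h) +
          ∑ l ∈ tt, bb l • (gaugePhase (twistFlipExp (γ l) (fl l) (mt l)) (yw l) •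
              fermionEmbed (PolySite.incl (hsh l))
                (fermionEmbed (PolySite.d4Emb (γ l) (wv l) Λ) (spinSwapIter (fl l).val (ladderWord (yw l)))) -
            fermionEmbed (PolySite.incl hΛ) (ladderWord (yw l))) +
          ∑ j ∈ u, b j • ladderWord (cw j)) +
        (∑ m' ∈ ah, ((dc m' : ℝ) : ℂ) • ((V m')ᴴ - V m') + ∑ k ∈ w, a k • ladderWord (word k)) +
        kktForm (pairSourceWindowHamiltonianTT' dWaveFormFactor Λ' tp U μ h) G
          (fun b' => fermionEmbed (PolySite.incl hΛ) (Bk b')) := by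
    rw [Complex.ofReal_zero, zero_smul, sub_zero, Complex.ofReal_one, one_smul, zero_sub, neg_sub]
    exact hcert
  have hmain := re_orbitState_ge_of_twistedFlip_sourced_window_certificate_TT'_kkt_ineq tp U μ h hL hΛ h8 h0 hz hP hInj
    hInj' h1S hmulS hψK hψ1 hHψ 0 1 c hΛm O s B tt γ hγS wv fl mt hsh bb yw u b cw hcw ah dc V w a word hG Bk hcert'
  rw [map_zero, map_zero, Complex.zero_re] at hmain
  have hL2 : (0 : ℝ) < (L : ℝ) ^ 2 := by
    have : (0 : ℝ) < (L : ℝ) := by exact_mod_cast Nat.pos_of_ne_zero (NeZero.ne L)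
    positivity
  have hle : c - ∑ k ∈ w, ‖a k‖ ≤ (dWaveSourceTorusTT' L tp U μ h).groundEnergy / (L : ℝ) ^ 2 := by linarith
  exact (le_div_iff₀ hL2).1 hle

end TorusSourced

/-- **Eventual form** (library instances; the FLOOR slot `Summit.Ventures.CertifiedManyBodySolver.SourcedEnergyLowerRow`):
there is `L₀` with `(c − Σₖ ‖aₖ‖) · L² ≤ E₀(dWaveSourceTorusTT' L tp U μ h)` for every `L ≥ L₀`, from ONE window
identity with flip-twisted defects and a KKT block. [cite: AraujoEtAl2023, §3.2 Prop. 11] [cite: Han2020Bootstrap, §3] -/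
theorem dWaveSourceTorusTT'_groundEnergy_ge_of_twistedFlip_window_certificate_kkt_eventually (tp U μ h : ℝ)
    {Λ Λ' : Finset (Site 2)} (hΛ : Λ ⊆ Λ') (h8 : thicken Λ 1 ⊆ Λ')
    (h0 : thicken ({0} : Finset (Site 2)) 1 ⊆ Λ') (hz : (0 : Site 2) ∈ Λ')
    (hP : pairRegion (insert (0 : Site 2) unitSteps) 0 ⊆ Λ')
    {m : Type*} [Fintype m] [DecidableEq m] {Λm : Matrix m m ℂ} (hΛm : Λm.PosSemidef)
    (O : m → FermionOp Λ')
    {κ : Type*} (s : Finset κ) (B : κ → FermionOp Λ)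
    {ι : Type*} (tt : Finset ι) (γ : ι → DihedralGroup 4) (wv : ι → Site 2) (fl mt : ι → Fin 2)
    (hsh : ∀ l, d4ShiftSet (γ l) (wv l) Λ ⊆ Λ') (bb : ι → ℂ) (yw : ι → List (Orb (PolySite Λ) × Bool))
    {χ : Type*} (u : Finset χ) (b : χ → ℂ) (cw : χ → List (Orb (PolySite Λ') × Bool))
    (hcw : ∀ j ∈ u, ladderSpinCharge (cw j) ≠ 0)
    {δ : Type*} (ah : Finset δ) (dc : δ → ℝ) (V : δ → FermionOp Λ')
    {κ'' : Type*} (w : Finset κ'') (a : κ'' → ℂ) (word : κ'' → List (Orb (PolySite Λ') × Bool))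
    {β : Type*} [Fintype β] [DecidableEq β] {G : Matrix β β ℂ} (hG : G.PosSemidef)
    (Bk : β → FermionOp Λ) {c : ℝ}
    (hcert : fermionEmbed (PolySite.incl h0) ((hubbardTTPrimeFermionInteraction 1 tp U).meanEnergyObs 1) -
          (μ : ℂ) • ∑ σ : Fin 2, nAt 0 hz σ -
          (h : ℂ) • (fermionEmbed (PolySite.incl hP) (localPairAt (insert (0 : Site 2) unitSteps) dWaveFormFactor 0) +
            (fermionEmbed (PolySite.incl hP) (localPairAt (insert (0 : Site 2) unitSteps) dWaveFormFactor 0))ᴴ) -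
        (c : ℂ) • (1 : FermionOp Λ') =
      gramForm Λm O +
        (∑ k ∈ s, (pairSourceWindowHamiltonianTT' dWaveFormFactor Λ' tp U μ h * fermionEmbed (PolySite.incl hΛ) (B k) -
            fermionEmbed (PolySite.incl hΛ) (B k) * pairSourceWindowHamiltonianTT' dWaveFormFactor Λ' tp U μ h) +
          ∑ l ∈ tt, bb l • (gaugePhase (twistFlipExp (γ l) (fl l) (mt l)) (yw l) •
              fermionEmbed (PolySite.incl (hsh l))
                (fermionEmbed (PolySite.d4Emb (γ l) (wv l) Λ) (spinSwapIter (fl l).val (ladderWord (yw l)))) -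
            fermionEmbed (PolySite.incl hΛ) (ladderWord (yw l))) +
          ∑ j ∈ u, b j • ladderWord (cw j)) +
        (∑ m' ∈ ah, ((dc m' : ℝ) : ℂ) • ((V m')ᴴ - V m') + ∑ k ∈ w, a k • ladderWord (word k)) +
        kktForm (pairSourceWindowHamiltonianTT' dWaveFormFactor Λ' tp U μ h) G
          (fun b' => fermionEmbed (PolySite.incl hΛ) (Bk b'))) :
    ∃ L₀ : ℕ, ∀ (L : ℕ) [NeZero L], L₀ ≤ L →
      (c - ∑ k ∈ w, ‖a k‖) * (L : ℝ) ^ 2 ≤ (dWaveSourceTorusTT' L tp U μ h).groundEnergy := by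
  obtain ⟨L₁, hL₁⟩ := exists_forall_le_injOn_proj (thicken Λ' 1)
  refine ⟨max 3 L₁, fun L _ hL => ?_⟩
  convert dWaveSourceTorusTT'_groundEnergy_ge_of_twistedFlip_window_certificate_kkt tp U μ h (le_trans (le_max_left _ _) hL)
    hΛ h8 h0 hz hP (hL₁ L (le_trans (le_max_right _ _) hL)) hΛm O s B tt γ wv fl mt hsh bb yw u b cw hcw ah dc V w a
    word hG Bk hcert using 2

end Literature.MathematicalPhysics.QuantumLattice

end
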